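import Summits.QuantumFields.BalabanUV.T4Continuum.Support.NE7K1LinTorusResolventFibre
import Summits.QuantumFields.BalabanUV.T4Continuum.Support.NE7K1LinTorusLineASplit
import Summits.QuantumFields.BalabanUV.T4Continuum.Support.NE7K1LinTorusFloor

/-!
# NE7K1LinTorusResolventLine — row NE7 (node U5), candidate route HOM, path H1L, cell K1-lin(s): NEEDS-ESTIMATE #E1, R-E1 TRANCHE E
# (operator-level torus docking), STEP 2b — THE TWO-CUTOFF LINE'S RESOLVENT ON A COARSE PLANE WAVE: on the fine doubled torus
# `𝕋 = boxDom (dbl (n·M))` (an `n`-block union over the coarse torus `boxDom (dbl M)`), for every `a > 0`, `0 ≤ s ≤ 1` and every centred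
# coarse dual index `p`, the explicit field `Φ^R_p` of file 72 (eigenvalues `m̂_k = torSymb(s, q_k)` at the fibre momenta `q_k = p + 2M∘k`)
# satisfies `(T^𝕋(s) + a·Q_n^*Q_n)·Φ^R_p = χ_p ∘ blk_n` — B4 (2.44)–(2.47) for the LINE, at the operator level, every `s`

Lineage `b2b-balaban-t4-ne7-p2` (CRUX PROVER NE7 #2), generation 76; file 74.  File 72 (§4): `soft_resolvent_regrouped` for any fine operator
with the fibre waves as eigenvectors; file 73: `torLine(n,a,s) = torLine(n,0,s) + (a∕n^{d+1})·1[same n-block]`; file 37: plane waves are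
eigenvectors of the torus line `torLineRep` (`torLine_zero_planeWave`, eigenvalue `torSymb`); file 39: the floor `torSymb ≥ n²Σ(2 − 2cos)`.
THIS FILE ([folklore] assembly):

* §1 the geometry: `dbl (n·M) = n·dbl M`, the fine doubled torus is an `n`-block union (`fineTorus_isBlockUnion`).
* §2 the eigenvalue family **`mhatT hn M s y₀ p k = torSymb hn M s y₀ (fibMom (dbl M) p k)`**: real (`torSymb_im_eq_zero`), `≥ 0`, and
  `> 0` off the base residue (`k ≠ 0` ⇒ one fibre coordinate `q_{k,ν} ∈ [1, 2nM_ν − 1]`, so `cos < 1` in file 39's floor) — for centred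
  `2|p_μ| ≤ 2M_μ`; the regrouped denominator **`ESf ≠ 0`**: its real part is `≥ a·U_0(θ(p)) ≥ a(4∕π²)^{d+1} > 0` (`B4Strip.Ur_zero_ge`).
* §3 **`torLineRepA hn M a s`** (the line WITH its averaging term, transported to `boxDom (dbl (n·M))` as file 37's `torLineRep` is) and
  `torLineRepA_apply` (`= torLineRep + (a∕n^{d+1})·1[same n-block]`, file 73); **`line_resolvent_wave`**:
  `Σ_{x′} torLineRepA(x,x′)·Φ^R_p(x′) = χ_p(blk_n x)` for every `x ∈ 𝕋`, every `a > 0`, `0 ≤ s ≤ 1`, centred `p` — the line's resolvent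
  applied to `Q_n^*χ_p` IS file 72's explicit fibre field (with `isUnit_det_torLine`, file 34, this identifies `(torLine(n,a,s))⁻¹Q_n^*χ_p`).

NEXT (step 3): Fourier inversion over `p ∈ boxDom (dbl M)` (`sum_chiT_dual`, file 60) and the identification `m̂_k = lineSymb L n s (n·θ(q_k))`
(`torSymb_eq_ofReal` + `lineSymb_eq_torSymb` + periodicity) ⇒ `((torLine(n,a,s))⁻¹·bsumᵀ)(n x⁰ + τ, β) = torusKernelS n (lineSymb L n s) a τ (dbl M) (x⁰ − β)`
(file 68) — the operator-level docking of R-E1.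

HONEST FRAMING: [folklore] assembly of this lineage's identities; nothing of Bałaban's asserted; no `sorry`.  Census only; NE7 NOT PRINTED ∕ NOT
PROVED; spine 0∕9; FIXED FINITE T⁴, rung (B)+1; NOT infinite volume, NOT mass gap, NOT Clay.  HONEST DEPENDENCY: continuum YM on T⁴ ⇐ BetaPertH
∧ nine spine estimates (0/9 proved); BetaPertH ⇐ (D1) ∧ (D4) ∧ CAP+tail; G-an2-4 gates asym, D1 and NE2/3/4.
-/

noncomputable section

open Finset Matrix Complex

namespace Summit.QuantumFields.BalabanUV.T4Continuum.NE7K1LinTorusResolventLine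

open Literature.MathematicalPhysics.QuantumFieldTheory.Balaban1983to89
open Literature.MathematicalPhysics.QuantumFieldTheory.Balaban1983to89.B4Reflection242
open Literature.MathematicalPhysics.QuantumFieldTheory.Balaban1983to89.B4Lower18
open Literature.MathematicalPhysics.QuantumFieldTheory.Balaban1983to89.B4Strip (Ur Ur_zero_ge Ur_nonneg)
open NE7K1LinFoldKernels NE7K1LinFoldMatrices NE7K1LinSchurFoldBox NE7K1LinTorusLineInvariant NE7K1LinSchurLineU1 NE7K1LinTorusLineSymbol
open NE7K1LinTorusSymbolReal NE7K1LinTorusFloor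
open NE7K1LinTorusFineWaves NE7K1LinTorusFineWavesFibre NE7K1LinTorusResolventFibre NE7K1LinTorusLineASplit

variable {d : ℕ}

/-! ### §1 The fine doubled torus over the coarse doubled torus -/

/-- `dbl (n·M) = n·dbl M`. [folklore] -/
theorem dbl_nmul (n : ℕ) (M : Fin (d + 1) → ℕ) : dbl (fun i => n * M i) = fun i => n * dbl M i := by
  funext i; simp only [dbl_apply]; ring

/-- the fine doubled torus `boxDom (dbl (n·M))` is a union of `n`-blocks. [folklore] -/
theorem fineTorus_isBlockUnion {n : ℕ} (hn : 1 ≤ n) (M : Fin (d + 1) → ℕ) : IsBlockUnion n (boxDom (dbl fun i => n * M i)) := by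
  rw [dbl_nmul]
  exact boxDom_isBlockUnion hn _

/-! ### §2 The eigenvalue family of the torus line on an alias fibre and its non-vanishing -/

section Eigen

variable {n L : ℕ} [NeZero n] [NeZero L] {M : Fin (d + 1) → ℕ}

/-- THE EIGENVALUES OF THE TORUS LINE ON THE FIBRE OF `p`: `m̂_k = torSymb(s, q_k)`, `q_k = p + (dbl M)∘k`. [folklore] -/
def mhatT (hn : 1 ≤ n) (M : Fin (d + 1) → ℕ) (s : ℝ) (y₀ : ↥(boxDom (dbl fun i => n * M i))) (p : Fin (d + 1) → ℤ)
    (k : Fin (d + 1) → Fin n) : ℂ :=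
  torSymb (L := L) hn M s y₀ (fibMom (dbl M) p k)

omit [NeZero n] in
/-- the eigen-relation on the fibre waves (file 37's `torLine_zero_planeWave` at the fibre momenta). [folklore] -/
theorem torLineRep_fibWave (hn : 1 ≤ n) (hM : ∀ i, 1 ≤ M i) (s : ℝ) (y₀ : ↥(boxDom (dbl fun i => n * M i)))
    (p : Fin (d + 1) → ℤ) (k : Fin (d + 1) → Fin n) (x : ↥(boxDom (dbl fun i => n * M i))) :
    ∑ x' : ↥(boxDom (dbl fun i => n * M i)), (torLineRep (L := L) hn M s x x' : ℂ) *
        chiT (dbl fun i => n * M i) (fibMom (dbl M) p k) x'.1 =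
      mhatT (L := L) hn M s y₀ p k * chiT (dbl fun i => n * M i) (fibMom (dbl M) p k) x.1 :=
  torLine_zero_planeWave hn hM s y₀ x _

omit [NeZero n] in
/-- the eigenvalues are real. [folklore] -/
theorem mhatT_eq_ofReal (hn : 1 ≤ n) (hM : ∀ i, 1 ≤ M i) (s : ℝ) (y₀ : ↥(boxDom (dbl fun i => n * M i)))
    (p : Fin (d + 1) → ℤ) (k : Fin (d + 1) → Fin n) :
    mhatT (L := L) hn M s y₀ p k = (((mhatT (L := L) hn M s y₀ p k).re : ℝ) : ℂ) := by
  apply Complex.ext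
  · simp
  · rw [Complex.ofReal_im]; exact torSymb_im_eq_zero hn hM s y₀ _

omit [NeZero n] in
/-- the eigenvalues are `≥ 0` for `s ≥ 0` (file 39's floor is a sum of nonnegative terms). [folklore] -/
theorem mhatT_re_nonneg (hn : 1 ≤ n) (hM : ∀ i, 1 ≤ M i) {s : ℝ} (hs0 : 0 ≤ s) (y₀ : ↥(boxDom (dbl fun i => n * M i)))
    (p : Fin (d + 1) → ℤ) (k : Fin (d + 1) → Fin n) : 0 ≤ (mhatT (L := L) hn M s y₀ p k).re := by
  have h := torSymb_re_ge_nn (L := L) hn hM hs0 y₀ (fibMom (dbl M) p k)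
  have h0 : 0 ≤ (n : ℝ) ^ 2 * ∑ μ : Fin (d + 1),
      (2 - 2 * Real.cos (2 * Real.pi * (fibMom (dbl M) p k μ : ℝ) / (dbl (fun i => n * M i) μ : ℝ))) := by
    apply mul_nonneg (by positivity)
    refine Finset.sum_nonneg (fun μ _ => ?_)
    have hc := Real.cos_le_one (2 * Real.pi * (fibMom (dbl M) p k μ : ℝ) / (dbl (fun i => n * M i) μ : ℝ))
    linarith
  exact h0.trans h

omit [NeZero n] in
/-- a fibre coordinate with a non-zero residue is not a multiple of the fine period: `1 ≤ q_{k,ν} ≤ 2nM_ν − 1` for `|p_ν| < 2M_ν`,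
`1 ≤ k_ν ≤ n − 1`, hence `cos(2π q_{k,ν}∕2nM_ν) < 1`. [folklore] -/
theorem cos_fib_lt_one (hn : 1 ≤ n) (hM : ∀ i, 1 ≤ M i) {p : Fin (d + 1) → ℤ} (hp : ∀ μ, |p μ| < (dbl M μ : ℤ))
    (k : Fin (d + 1) → Fin n) {ν : Fin (d + 1)} (hk : (k ν : ℕ) ≠ 0) :
    Real.cos (2 * Real.pi * (fibMom (dbl M) p k ν : ℝ) / (dbl (fun i => n * M i) ν : ℝ)) < 1 := by
  have hP0 : (0 : ℝ) < (dbl (fun i => n * M i) ν : ℝ) := by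
    have := dbl_pos (mul_pos_side hn hM) ν; exact_mod_cast (show 0 < dbl (fun i => n * M i) ν by omega)
  have hq : fibMom (dbl M) p k ν = p ν + (dbl M ν : ℤ) * (k ν : ℕ) := by simp [fibMom, kvec]
  have hkn : (k ν : ℕ) + 1 ≤ n := (k ν).isLt
  have hk1 : 1 ≤ (k ν : ℕ) := Nat.one_le_iff_ne_zero.mpr hk
  have hpν := abs_lt.mp (hp ν)
  have hM2 : (dbl M ν : ℤ) = 2 * M ν := by simp [dbl_apply]
  have hPν : (dbl (fun i => n * M i) ν : ℤ) = 2 * (n * M ν) := by simp [dbl_apply]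
  -- `0 < q < P` as integers
  have hq_pos : 0 < fibMom (dbl M) p k ν := by rw [hq]; nlinarith [hM ν]
  have hq_lt : fibMom (dbl M) p k ν < (dbl (fun i => n * M i) ν : ℤ) := by
    rw [hq, hPν, hM2]
    have : (k ν : ℕ) ≤ n - 1 := by omega
    have h1 : ((k ν : ℕ) : ℤ) ≤ (n : ℤ) - 1 := by omega
    nlinarith [hM ν]
  -- if `cos = 1` the angle is an integer multiple of `2π`, i.e. `q∕P ∈ ℤ` — impossible in `(0,1)`
  refine lt_of_le_of_ne (Real.cos_le_one _) (fun h => ?_)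
  obtain ⟨m, hm⟩ := (Real.cos_eq_one_iff _).mp h
  have hmq : (m : ℝ) * (dbl (fun i => n * M i) ν : ℝ) = (fibMom (dbl M) p k ν : ℝ) := by
    have := hm; field_simp at this; nlinarith [Real.pi_pos, this]
  have hmq' : (m : ℤ) * (dbl (fun i => n * M i) ν : ℤ) = fibMom (dbl M) p k ν := by exact_mod_cast hmq
  have hm0 : 0 < m := by
    by_contra hle
    have hle' : m ≤ 0 := not_lt.mp hle
    have : (m : ℤ) * (dbl (fun i => n * M i) ν : ℤ) ≤ 0 :=
      mul_nonpos_of_nonpos_of_nonneg hle' (by exact_mod_cast (Nat.zero_le _))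
    omega
  have : (dbl (fun i => n * M i) ν : ℤ) ≤ (m : ℤ) * (dbl (fun i => n * M i) ν : ℤ) :=
    le_mul_of_one_le_left (by exact_mod_cast (Nat.zero_le _)) hm0
  omega

/-- **the eigenvalues off the base residue are positive**: `k ≠ 0 ⇒ Re m̂_k > 0` (centred or raw `p` with `|p_μ| < 2M_μ`, `s ≥ 0`). [folklore] -/
theorem mhatT_re_pos (hn : 1 ≤ n) (hM : ∀ i, 1 ≤ M i) {s : ℝ} (hs0 : 0 ≤ s) (y₀ : ↥(boxDom (dbl fun i => n * M i)))
    {p : Fin (d + 1) → ℤ} (hp : ∀ μ, |p μ| < (dbl M μ : ℤ)) (k : Fin (d + 1) → Fin n) (hk : k ≠ fun _ => 0) :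
    0 < (mhatT (L := L) hn M s y₀ p k).re := by
  obtain ⟨ν, hν⟩ := Function.ne_iff.mp hk
  have hkν : (k ν : ℕ) ≠ 0 := fun e => hν (Fin.ext (by rw [e, Fin.val_zero]))
  have h := torSymb_re_ge_nn (L := L) hn hM hs0 y₀ (fibMom (dbl M) p k)
  have hn0 : (0 : ℝ) < (n : ℝ) ^ 2 := by
    have h1 : (0 : ℝ) < n := by exact_mod_cast (show 0 < n by omega)
    positivity
  have hterm : ∀ μ : Fin (d + 1), 0 ≤ 2 - 2 * Real.cos (2 * Real.pi * (fibMom (dbl M) p k μ : ℝ) / (dbl (fun i => n * M i) μ : ℝ)) :=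
    fun μ => by linarith [Real.cos_le_one (2 * Real.pi * (fibMom (dbl M) p k μ : ℝ) / (dbl (fun i => n * M i) μ : ℝ))]
  have hν' : 0 < 2 - 2 * Real.cos (2 * Real.pi * (fibMom (dbl M) p k ν : ℝ) / (dbl (fun i => n * M i) ν : ℝ)) := by
    linarith [cos_fib_lt_one hn hM hp k hkν]
  have hsum : 0 < ∑ μ : Fin (d + 1), (2 - 2 * Real.cos (2 * Real.pi * (fibMom (dbl M) p k μ : ℝ) / (dbl (fun i => n * M i) μ : ℝ))) :=
    lt_of_lt_of_le hν' (Finset.single_le_sum (fun μ _ => hterm μ) (Finset.mem_univ ν))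
  exact lt_of_lt_of_le (mul_pos hn0 hsum) h

/-- the eigenvalues off the base residue do not vanish. [folklore] -/
theorem mhatT_ne_zero (hn : 1 ≤ n) (hM : ∀ i, 1 ≤ M i) {s : ℝ} (hs0 : 0 ≤ s) (y₀ : ↥(boxDom (dbl fun i => n * M i)))
    {p : Fin (d + 1) → ℤ} (hp : ∀ μ, |p μ| < (dbl M μ : ℤ)) (k : Fin (d + 1) → Fin n) (hk : k ≠ fun _ => 0) :
    mhatT (L := L) hn M s y₀ p k ≠ 0 := fun e => by
  have := mhatT_re_pos (L := L) hn hM hs0 y₀ hp k hk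
  rw [e, Complex.zero_re] at this
  exact lt_irrefl _ this

/-- **the regrouped denominator does not vanish**: `Re ESf ≥ a·U_0(θ(p)) ≥ a(4∕π²)^{d+1} > 0` for `a > 0`, `s ≥ 0` and CENTRED `p`
(`2|p_μ| ≤ 2M_μ`, so `|θ(p)_μ| ≤ π` and b04's `Ur_zero_ge` applies). [folklore] -/
theorem ESf_line_ne_zero (hn : 1 ≤ n) (hM : ∀ i, 1 ≤ M i) {s : ℝ} (hs0 : 0 ≤ s) (y₀ : ↥(boxDom (dbl fun i => n * M i)))
    {p : Fin (d + 1) → ℤ} (hp : ∀ μ, 2 * |p μ| ≤ (dbl M μ : ℤ)) {a : ℝ} (ha : 0 < a) :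
    ESf n (dbl M) (mhatT (L := L) hn M s y₀ p) a p ≠ 0 := by
  have hPc : ∀ i, 1 ≤ dbl M i := dbl_pos hM
  have hp' : ∀ μ, |p μ| < (dbl M μ : ℤ) := fun μ => by
    have h1 := hp μ; have h2 : (1 : ℤ) ≤ (dbl M μ : ℤ) := by exact_mod_cast hPc μ
    have := abs_nonneg (p μ); omega
  have hm : ∀ k, mhatT (L := L) hn M s y₀ p k = (((mhatT (L := L) hn M s y₀ p k).re : ℝ) : ℂ) :=
    fun k => mhatT_eq_ofReal hn hM s y₀ p k
  have hr0 : ∀ k, 0 ≤ (mhatT (L := L) hn M s y₀ p k).re := fun k => mhatT_re_nonneg hn hM hs0 y₀ p k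
  have hrpos : ∀ k, k ≠ (fun _ => 0) → 0 < (mhatT (L := L) hn M s y₀ p k).re :=
    fun k hk => mhatT_re_pos hn hM hs0 y₀ hp' k hk
  have hθ : ∀ μ, |thetaOf (dbl M) p μ| ≤ Real.pi := fun μ => by
    have hP0 : (0 : ℝ) < dbl M μ := by exact_mod_cast hPc μ
    have h : 2 * |(p μ : ℝ)| ≤ (dbl M μ : ℝ) := by exact_mod_cast hp μ
    rw [thetaOf, abs_div, abs_of_pos hP0, div_le_iff₀ hP0, abs_mul, abs_of_pos (by positivity : (0 : ℝ) < 2 * Real.pi)]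
    nlinarith [Real.pi_pos]
  have hU0 : (4 / Real.pi ^ 2) ^ (d + 1) ≤ Ur n (fun _ => (0 : Fin n)) (thetaOf (dbl M) p) := Ur_zero_ge n hn _ hθ
  have hU0pos : 0 < Ur n (fun _ => (0 : Fin n)) (thetaOf (dbl M) p) := lt_of_lt_of_le (by positivity) hU0
  -- the denominator is the real number `r 0 + aU_0 + aΣ_{k≠0} U_k r_0∕r_k`
  set r0 : ℝ := (mhatT (L := L) hn M s y₀ p (fun _ => 0)).re with hr0def
  have hreal : ESf n (dbl M) (mhatT (L := L) hn M s y₀ p) a p =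
      ((r0 + a * Ur n (fun _ => (0 : Fin n)) (thetaOf (dbl M) p) +
        a * ∑ k ∈ Finset.univ.erase (fun _ => (0 : Fin n)),
          Ur n k (thetaOf (dbl M) p) * (r0 / (mhatT (L := L) hn M s y₀ p k).re) : ℝ) : ℂ) := by
    unfold ESf
    rw [hm (fun _ => 0)]
    rw [Finset.sum_congr rfl (fun k _ => by rw [hm k])]
    push_cast
    rfl
  intro e
  rw [hreal, Complex.ofReal_eq_zero] at e
  have hsum : 0 ≤ ∑ k ∈ Finset.univ.erase (fun _ => (0 : Fin n)),
      Ur n k (thetaOf (dbl M) p) * (r0 / (mhatT (L := L) hn M s y₀ p k).re) :=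
    Finset.sum_nonneg (fun k hk => mul_nonneg (Ur_nonneg _ _ _)
      (div_nonneg (hr0 _) (hrpos k (Finset.ne_of_mem_erase hk)).le))
  nlinarith [hr0 (fun _ => 0), mul_pos ha hU0pos, mul_nonneg ha.le hsum]

end Eigen

/-! ### §3 The line's resolvent on a coarse plane wave -/

section Resolvent

variable {n L : ℕ} [NeZero n] [NeZero L] {M : Fin (d + 1) → ℕ}

/-- the two-cutoff line WITH its averaging term, transported to the representatives `boxDom (dbl (n·M))` (as file 37's `torLineRep`
is for `a = 0`). [folklore] -/
def torLineRepA (hn : 1 ≤ n) (M : Fin (d + 1) → ℕ) (a s : ℝ) :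
    Matrix ↥(boxDom (dbl fun i => n * M i)) ↥(boxDom (dbl fun i => n * M i)) ℝ :=
  fun x y => torLine (isBlockUnion_fine (fineTor_isBlockUnion hn (NeZero.one_le : 1 ≤ L) M)) n a (fun i => n * L * M i)
    (fun i => n * M i) s ⟨x.1, by rw [image_fineTor (NeZero.one_le : 1 ≤ L) n M]; exact x.2⟩
    ⟨y.1, by rw [image_fineTor (NeZero.one_le : 1 ≤ L) n M]; exact y.2⟩

omit [NeZero n] in
/-- **the transported `a`-split** (file 73): `torLineRepA = torLineRep + (a∕n^{d+1})·1[same n-block]`. [folklore] -/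
theorem torLineRepA_apply (hn : 1 ≤ n) (M : Fin (d + 1) → ℕ) (a s : ℝ) (x y : ↥(boxDom (dbl fun i => n * M i))) :
    torLineRepA (L := L) hn M a s x y = torLineRep (L := L) hn M s x y +
      (if blk n y.1 = blk n x.1 then a * ((n : ℝ) ^ (d + 1))⁻¹ else 0) := by
  unfold torLineRepA torLineRep
  rw [torLine_apply_eq_add _ hn]

/-- **THE LINE'S RESOLVENT ON A COARSE PLANE WAVE (B4 (2.44)–(2.47) for the two-cutoff line, operator level)**: for `a > 0`, `0 ≤ s`,
every mesh `n ≥ 1`, every torus `M` and every CENTRED coarse dual index `2|p_μ| ≤ 2M_μ`, file 72's regrouped field `Φ^R_p` with the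
eigenvalues `m̂_k = torSymb(s, q_k)` satisfies `Σ_{x′} (T^𝕋(s) + a·Q_n^*Q_n)(x, x′)·Φ^R_p(x′) = χ_p(blk_n x)` at every fine point. [folklore] -/
theorem line_resolvent_wave (hn : 1 ≤ n) (hM : ∀ i, 1 ≤ M i) {a : ℝ} (ha : 0 < a) {s : ℝ} (hs0 : 0 ≤ s)
    (y₀ : ↥(boxDom (dbl fun i => n * M i))) {p : Fin (d + 1) → ℤ} (hp : ∀ μ, 2 * |p μ| ≤ (dbl M μ : ℤ))
    (x : ↥(boxDom (dbl fun i => n * M i))) :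
    ∑ x' : ↥(boxDom (dbl fun i => n * M i)), (torLineRepA (L := L) hn M a s x x' : ℂ) *
        resFieldR n (dbl fun i => n * M i) (dbl M) (mhatT (L := L) hn M s y₀ p) a p x'.1 =
      chiT (dbl M) p (blk n x.1) := by
  have hPc : ∀ i, 1 ≤ dbl M i := dbl_pos hM
  have hp' : ∀ μ, |p μ| < (dbl M μ : ℤ) := fun μ => by
    have h1 := hp μ; have h2 : (1 : ℤ) ≤ (dbl M μ : ℤ) := by exact_mod_cast hPc μ
    have := abs_nonneg (p μ); omega
  have hT := fineTorus_isBlockUnion hn M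
  have key := soft_resolvent_regrouped (dbl_nmul n M) hPc hT (torLineRep (L := L) hn M s)
    (mhatT (L := L) hn M s y₀ p) (fun k hk => mhatT_ne_zero hn hM hs0 y₀ hp' k hk) hp'
    (fun k x => torLineRep_fibWave hn hM s y₀ p k x) a (ESf_line_ne_zero hn hM hs0 y₀ hp ha) x
  -- rewrite the full line as `torLineRep + (a∕n^{d+1})·1[same block]` and split the sum
  change _ = chiT (dbl M) p (rblk n (boxDom (dbl fun i => n * M i)) x).1
  simp_rw [torLineRepA_apply, Complex.ofReal_add, add_mul, Finset.sum_add_distrib]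
  rw [← key]
  congr 1
  have e : ∀ x' : ↥(boxDom (dbl fun i => n * M i)),
      (((if blk n x'.1 = blk n x.1 then a * ((n : ℝ) ^ (d + 1))⁻¹ else 0 : ℝ) : ℂ)) *
          resFieldR n (dbl fun i => n * M i) (dbl M) (mhatT (L := L) hn M s y₀ p) a p x'.1 =
        if rblk n (boxDom (dbl fun i => n * M i)) x' = rblk n (boxDom (dbl fun i => n * M i)) x then
          (a : ℂ) * ((n : ℂ) ^ (d + 1))⁻¹ * resFieldR n (dbl fun i => n * M i) (dbl M) (mhatT (L := L) hn M s y₀ p) a p x'.1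
        else 0 := by
    intro x'
    by_cases h : blk n x'.1 = blk n x.1
    · have h' : rblk n (boxDom (dbl fun i => n * M i)) x' = rblk n (boxDom (dbl fun i => n * M i)) x := Subtype.ext h
      rw [if_pos h, if_pos h']
      push_cast
      ring
    · have h' : rblk n (boxDom (dbl fun i => n * M i)) x' ≠ rblk n (boxDom (dbl fun i => n * M i)) x :=
        fun e => h (congrArg Subtype.val e)
      rw [if_neg h, if_neg h']
      push_cast
      ring
  rw [Finset.sum_congr rfl (fun x' _ => e x'), Finset.sum_ite, Finset.sum_const_zero, add_zero, ← Finset.mul_sum]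

end Resolvent

end Summit.QuantumFields.BalabanUV.T4Continuum.NE7K1LinTorusResolventLine

end
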